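import Summits.QuantumFields.BalabanUV.Beta.EriceRemainderEnclosureHistoryAutonomyComparisonIsotoneExcess
import Summits.QuantumFields.BalabanUV.Beta.EriceRemainderEnclosureHistoryAutonomyOrderScreening

/-!
# EriceRemainderEnclosureHistoryAutonomyComparisonAdvantage — (E61e) THE SIZE OF THE ADVANTAGE OF A FLOOR SHIFT: for ISOTONE memory with a zeroth moment
# `M` and floor `b > 0` on ]0,γ] at or below the threshold `M·γ ≤ 3√3·b`, raising the floor by `ε ≥ 0` raises the recursion variable of the running
# coupling at scale `m` by AT MOST `m·ε` and AT LEAST `(1 − M·p∕(3√3·b))·e^{−M·p∕b}·m·ε` (pin `p`): the advantage GROWS LINEARLY in the scale with an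
# explicit rate — the quantitative step `ξ ≥ (1 − q)·ε` at every deeper pin, screened only by the summable pin-sensitivity of the base family
# (`advantage_between`)

Cell `pub-balaban`, β-function sub-cell, BINDER row D4 «RemainderConst leaves for Bałaban's split» (`HOME/BINDER-OWNERS.md`; owner lineage `b2b-balaban-beta-an4`;
this file by co-owner #2 lineage `b2b-balaban-beta-d4-p2`, generation 54), β-FLOW TEAM duty (1), FREEZE (0) honoured (def-free; (E49k)'s
`family_le_of_isotone_excess`, (E48c)'s `abs_sub_le_of_monotone'`, (E48a)'s `family_mem` ∕ `family_tail_eq` ∕ `strictMonoOn_scale` ∕ `le_pin_of_memFlow`,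
(E49j)'s `seqBox_of_le_pin` ∕ `seqBox_mono`, (E38a)'s `three_sqrt_three_pos` ∕ `weight_sharp_le` ∕ `le_inv_sqrt_of_le_inv_sq`, (E39) `exists_memFlow_zm`, (E43b)
`memFlow_unique_of_monotone_zm`, node U2's `invSq_eq_of_memFlow` ∕ `mul_lower_le_drive` ∕ `Sharpness.abs_sub_le_half_cube_mul` BY NAME; nothing restated).
Answers the census row «SIZE OF THE ADVANTAGE (consumers: «how much smaller»)» of `HOME/b2b-balaban-beta-d4-p2/HISTORY-CHANNEL.md` for floor shifts, and
gives a lower bound on the growth of the lead of (E61b) `…ComparisonBarrierShift`.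

HONEST FRAMING (page 1, verbatim and binding).  *"Discharging BetaPertH makes Bałaban's UV stability UNCONDITIONAL — a real constructive-QFT result; it is
NOT the continuum limit and NOT the Clay problem."*  THIS FILE DISCHARGES NOTHING OF THE KIND.  Elementary real analysis about ABSTRACT functionals on a box
]0,γ]^ℕ with displayed floors, moduli and signs — hypotheses of a census, not facts; the form, signs and moments of Bałaban's (1.22) limit functional are NOT
PRINTED ([I] p. 298; GAPS G-t4-U2-1∕-2) and NOT asserted.  Row D4 class UNCHANGED (critical-path width 0; instance 0∕1; D4 DISCHARGE NO DATE).  HONEST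
DEPENDENCY: continuum YM on T⁴ ⇐ BetaPertH ∧ nine spine estimates (0/9 proved); BetaPertH ⇐ (D1) ∧ (D4) ∧ CAP+tail; G-an2-4 gates asym, D1 and NE2/3/4.

THE POINT (census sense (α); the COMPARISON column of the autonomy row).  Let `h = S p`, `h′ = S′ p` be the box solutions of `B` and `B + ε` from one pin and
`δ_m = 1∕h′_m² − 1∕h_m²` the ADVANTAGE of the raised floor at scale `m`.  By (E49k) `δ ≥ 0` at or below the threshold.  HOW LARGE is it?  The flow
equations give `δ_{m+1} − δ_m = ε − [B(S z′) − B(S′ z′)] − [B(S z) − B(S z′)]` with `z = h_{m+1} ≥ z′ = h′_{m+1}`: (i) the first bracket is the drop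
of the effective β-function between the two flows AT ONE pin `z′` and is `≤ q·ε`, `q = M·p∕(3√3·b)` ((E49j)(2)'s estimate kept quantitative:
§1 `drop_le_q_mul`); (ii) the second is the PIN-SENSITIVITY of the base effective β-function between the two current pins and is `≤ (M·z³∕2)·δ_{m+1}`
((E48c): isotone memory screens, `|S z j − S z′ j| ≤ (z³∕2)·(1∕z′² − 1∕z²)`).  Hence `δ_{m+1}·(1 + M·h_{m+1}³∕2) ≥ δ_m + (1 − q)·ε` (§2 `advantage_succ_ge`)
and, the damping exponents being summable along the asymptotic-freedom envelope (`Σ_{j≥1} h_j³ ≤ 2p∕b`, a telescope — §2 `sum_cube_envelope_le`),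
`δ_m ≥ (1 − q)·e^{−M·p∕b}·m·ε` (§3 `advantage_ge_linear`); the upper bound `δ_m ≤ m·ε` is the level bookkeeping of (E49j)∕(E58b) (§1
`advantage_le_linear`).  §4 **`advantage_between`** is the family-free END.  So at or below the threshold the perturbed recursion variable runs AHEAD
by a definite fraction of `m·ε` at every scale (the fraction `→ 1 − q` as the damping switches off), i.e. the time-shift lead of (E61b) grows at least
linearly — the first LOWER bound of the comparison column.  NOT CLAIMED: the optimal rate (numerically `δ_m∕(mε) → 1` in the UV and `≈ 2∕(2+Q)` near
the pin); anything above the threshold; anything printed.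

WHAT IS PROVED ([folklore]; 0 `def`, 0 sorry).  §1 `level_gap_le`, **`drop_le_q_mul`**, `advantage_le_linear`.  §2 `sum_cube_envelope_le`, **`advantage_succ_ge`**.
§3 **`advantage_ge_linear`**.  §4 **`advantage_between`**.
-/
noncomputable section
open Finset Set

namespace Summit.QuantumFields.BalabanUV.Beta.EriceRemainderEnclosureHistoryAutonomyComparisonAdvantage

open Literature.MathematicalPhysics.QuantumFieldTheory.Balaban1983to89
open Literature.MathematicalPhysics.QuantumFieldTheory.Balaban1983to89.T4BetaStationary
open Literature.MathematicalPhysics.QuantumFieldTheory.Balaban1983to89.T4BetaFlowWellPosed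
open Literature.MathematicalPhysics.QuantumFieldTheory.Balaban1983to89.T4BetaFlowWellPosed.Sharpness (abs_sub_le_half_cube_mul)
open Summit.QuantumFields.BalabanUV.Beta.EriceRemainderEnclosureHistoryAutonomyThreshold
  (three_sqrt_three_pos weight_sharp_le le_inv_sqrt_of_le_inv_sq)
open Summit.QuantumFields.BalabanUV.Beta.EriceRemainderEnclosureHistoryAutonomyOrder
open Summit.QuantumFields.BalabanUV.Beta.EriceRemainderEnclosureHistoryAutonomyOrderScreening (abs_sub_le_of_monotone')
open Summit.QuantumFields.BalabanUV.Beta.EriceRemainderEnclosureHistoryAutonomyComparisonExcess (seqBox_of_le_pin seqBox_mono)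
open Summit.QuantumFields.BalabanUV.Beta.EriceRemainderEnclosureHistoryAutonomyComparisonIsotoneExcess (family_le_of_isotone_excess)
open Summit.QuantumFields.BalabanUV.Beta.EriceRemainderEnclosureHistoryAutonomyExistence (exists_memFlow_zm)
open Summit.QuantumFields.BalabanUV.Beta.EriceRemainderEnclosureHistoryAutonomyMonotoneGeneral (memFlow_unique_of_monotone_zm)

variable {B : (ℕ → ℝ) → ℝ} {M γ b y ε : ℝ} {h h' : ℕ → ℝ} {S S' : ℝ → ℕ → ℝ}

/-! ## §1 The level gap of an ordered floor-shift pair is at most `m·ε`; the drop at one pin is at most `q·ε` -/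

/-- **THE ADVANTAGE IS AT MOST `m·ε`**: `B` ISOTONE, `u`, `u′` box solutions of `B`, `B + ε` from one pin with `u′ ≤ u`; then
`0 ≤ 1∕u′_m² − 1∕u_m² ≤ m·ε` at every scale (each increment of the gap is `ε + B(u′(l+1+·)) − B(u(l+1+·)) ≤ ε`). [folklore] -/
theorem level_gap_le (hmono : ∀ u v : ℕ → ℝ, SeqBox γ u → SeqBox γ v → (∀ j, u j ≤ v j) → B u ≤ B v)
    {u u' : ℕ → ℝ} (hu : SeqBox γ u) (hf : MemFlow B y u) (hu' : SeqBox γ u') (hf' : MemFlow (fun v => B v + ε) y u')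
    (hle : ∀ j, u' j ≤ u j) (m : ℕ) : 0 ≤ 1 / u' m ^ 2 - 1 / u m ^ 2 ∧ 1 / u' m ^ 2 - 1 / u m ^ 2 ≤ (m : ℝ) * ε := by
  refine ⟨sub_nonneg.mpr (one_div_le_one_div_of_le (pow_pos (hu' m).1 2) (pow_le_pow_left₀ (hu' m).1.le (hle m) 2)), ?_⟩
  induction m with
  | zero => rw [hf.1, hf'.1]; simp
  | succ m ih =>
    have e := hf.2 m
    have e' := hf'.2 m
    simp only at e'
    have hB : B (fun j => u' (m + 1 + j)) ≤ B (fun j => u (m + 1 + j)) :=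
      hmono _ _ (seqBox_shift hu' (m + 1)) (seqBox_shift hu (m + 1)) fun j => hle (m + 1 + j)
    rw [e, e', Nat.cast_succ]
    linarith

/-- **THE DROP AT ONE PIN IS AT MOST `q·ε`, `q = M·y∕(3√3·b)`** — (E49j)(2)'s estimate kept quantitative: `B` ISOTONE with zeroth moment `M ≥ 0` and floor
`b > 0` on ]0,γ]; `u`, `u′` box solutions of `B`, `B + ε` (`ε ≥ 0`) from one pin `y` with `u′ ≤ u`.  Then `B u − B u′ ≤ (M·y∕(3√3·b))·ε`: the levels differ
by at most `m·ε` (`level_gap_le`), so `u_m − u′_m ≤ (c_m³∕2)·m·ε ≤ y∕(3√3·b)·ε` (`c_m = (1∕y² + m·b)^{−1∕2}`, (E38a) `weight_sharp_le`), and the zeroth moment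
turns the uniform gap into the drop. [folklore] -/
theorem drop_le_q_mul (hmono : ∀ u v : ℕ → ℝ, SeqBox γ u → SeqBox γ v → (∀ j, u j ≤ v j) → B u ≤ B v)
    (hB : ∀ u u' : ℕ → ℝ, SeqBox γ u → SeqBox γ u' → ∀ D : ℝ, (∀ j, |u j - u' j| ≤ D) → |B u - B u'| ≤ M * D)
    (hb : 0 < b) (hlo : ∀ u, SeqBox γ u → b ≤ B u) (hy : 0 < y) (hε : 0 ≤ ε)
    {u u' : ℕ → ℝ} (hu : SeqBox γ u) (hf : MemFlow B y u) (hu' : SeqBox γ u') (hf' : MemFlow (fun v => B v + ε) y u')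
    (hle : ∀ j, u' j ≤ u j) : B u - B u' ≤ M * y / (3 * Real.sqrt 3 * b) * ε := by
  have h33 : 0 < 3 * Real.sqrt 3 * b := mul_pos three_sqrt_three_pos hb
  have hgap : ∀ m, |u m - u' m| ≤ y / (3 * Real.sqrt 3 * b) * ε := by
    intro m
    obtain ⟨hlev0, hlev⟩ := level_gap_le hmono hu hf hu' hf' hle m
    set P : ℝ := 1 / y ^ 2 + (m : ℝ) * b with hP
    have hP0 : 0 < P := by positivity
    have huP : P ≤ 1 / u m ^ 2 := by rw [invSq_eq_of_memFlow hf m]; exact add_le_add le_rfl (mul_lower_le_drive hlo hu m)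
    have huP' : P ≤ 1 / u' m ^ 2 := huP.trans (by linarith)
    set C : ℝ := 1 / Real.sqrt P with hC
    have hC : u m ≤ C := le_inv_sqrt_of_le_inv_sq (hu m).1 hP0 huP
    have hC' : u' m ≤ C := le_inv_sqrt_of_le_inv_sq (hu' m).1 hP0 huP'
    have hw := abs_sub_le_half_cube_mul (hu m).1 (hu' m).1 hC hC'
    have hW : (m : ℝ) * (C ^ 3 / 2) ≤ y / (3 * Real.sqrt 3 * b) := weight_sharp_le hy hb m
    have habs : |1 / u m ^ 2 - 1 / u' m ^ 2| ≤ (m : ℝ) * ε := by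
      rw [abs_sub_comm, abs_of_nonneg hlev0]; exact hlev
    calc |u m - u' m| ≤ C ^ 3 / 2 * |1 / u m ^ 2 - 1 / u' m ^ 2| := hw
      _ ≤ C ^ 3 / 2 * ((m : ℝ) * ε) := mul_le_mul_of_nonneg_left habs (by positivity)
      _ = (m : ℝ) * (C ^ 3 / 2) * ε := by ring
      _ ≤ y / (3 * Real.sqrt 3 * b) * ε := mul_le_mul_of_nonneg_right hW hε
  have hdrop : |B u - B u'| ≤ M * (y / (3 * Real.sqrt 3 * b) * ε) := hB u u' hu hu' _ hgap
  have := (abs_le.mp hdrop).2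
  calc B u - B u' ≤ M * (y / (3 * Real.sqrt 3 * b) * ε) := this
    _ = M * y / (3 * Real.sqrt 3 * b) * ε := by ring

/-- **THE ADVANTAGE IS AT MOST `m·ε` (family form)**: with unique solution families `S` of `B` (isotone) and `S′` of `B + ε` comparing from the pin `y`,
`1∕(S′ y m)² − 1∕(S y m)² ≤ m·ε`. [folklore] -/
theorem advantage_le_linear (hmono : ∀ u v : ℕ → ℝ, SeqBox γ u → SeqBox γ v → (∀ j, u j ≤ v j) → B u ≤ B v)
    (hS : ∀ p, 0 < p → p ≤ γ → SeqBox γ (S p) ∧ MemFlow B p (S p))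
    (hS' : ∀ p, 0 < p → p ≤ γ → SeqBox γ (S' p) ∧ MemFlow (fun v => B v + ε) p (S' p))
    (hy : 0 < y) (hyγ : y ≤ γ) (hcomp : ∀ j, S' y j ≤ S y j) (m : ℕ) : 1 / S' y m ^ 2 - 1 / S y m ^ 2 ≤ (m : ℝ) * ε :=
  (level_gap_le hmono (hS y hy hyγ).1 (hS y hy hyγ).2 (hS' y hy hyγ).1 (hS' y hy hyγ).2 hcomp m).2

/-! ## §2 The screened recursion: `δ_{m+1}·(1 + M·h_{m+1}³∕2) ≥ δ_m + (1 − q)·ε`; the damping exponents are summable -/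

/-- **THE CUBES OF THE ENVELOPE ARE SUMMABLE**: `Σ_{j=1}^{m} (1∕y² + j·b)^{−3∕2} ≤ 2y∕b` — each term is at most the telescope step
`(2∕b)·((1∕y² + (j−1)b)^{−1∕2} − (1∕y² + j·b)^{−1∕2})`. [folklore] -/
theorem sum_cube_envelope_le (hb : 0 < b) (hy : 0 < y) : ∀ m : ℕ,
    ∑ j ∈ range m, (1 / Real.sqrt (1 / y ^ 2 + ((j : ℝ) + 1) * b)) ^ 3 ≤ 2 * y / b - 2 / (b * Real.sqrt (1 / y ^ 2 + (m : ℝ) * b))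
  | 0 => by
    have e : Real.sqrt (1 / y ^ 2 + ((0 : ℕ) : ℝ) * b) = 1 / y := by
      rw [Nat.cast_zero, zero_mul, add_zero, show (1 : ℝ) / y ^ 2 = (1 / y) ^ 2 by ring, Real.sqrt_sq (by positivity)]
    rw [sum_range_zero, e]
    have : 2 / (b * (1 / y)) = 2 * y / b := by field_simp
    rw [this]; linarith
  | m + 1 => by
    rw [sum_range_succ]
    have ih := sum_cube_envelope_le hb hy m
    -- the new term against one telescope step
    set x0 : ℝ := 1 / y ^ 2 + (m : ℝ) * b with hx0
    set x1 : ℝ := 1 / y ^ 2 + ((m : ℝ) + 1) * b with hx1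
    have hx0p : 0 < x0 := by positivity
    have hx1p : 0 < x1 := by positivity
    have hx01 : x0 ≤ x1 := by rw [hx0, hx1]; nlinarith
    have e1 : x1 - x0 = b := by rw [hx0, hx1]; ring
    have hs0 : 0 < Real.sqrt x0 := Real.sqrt_pos.mpr hx0p
    have hs1 : 0 < Real.sqrt x1 := Real.sqrt_pos.mpr hx1p
    have hs01 : Real.sqrt x0 ≤ Real.sqrt x1 := Real.sqrt_le_sqrt hx01
    have es0 : Real.sqrt x0 ^ 2 = x0 := Real.sq_sqrt hx0p.le
    have es1 : Real.sqrt x1 ^ 2 = x1 := Real.sq_sqrt hx1p.le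
    -- (1/√x1)³ ≤ (2/b)·(1/√x0 − 1/√x1)
    have hstep : (1 / Real.sqrt x1) ^ 3 ≤ 2 / (b * Real.sqrt x0) - 2 / (b * Real.sqrt x1) := by
      rw [div_pow, one_pow]
      have e2 : 2 / (b * Real.sqrt x0) - 2 / (b * Real.sqrt x1) = 2 * (Real.sqrt x1 - Real.sqrt x0) / (b * Real.sqrt x0 * Real.sqrt x1) := by
        field_simp
      rw [e2, div_le_div_iff₀ (by positivity) (by positivity)]
      -- b √x0 √x1 ≤ 2(√x1 − √x0) √x1³, using (√x1 − √x0)(√x1 + √x0) = b and √x0 ≤ √x1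
      have hprod : (Real.sqrt x1 - Real.sqrt x0) * (Real.sqrt x1 + Real.sqrt x0) = b := by nlinarith
      have hcube : Real.sqrt x1 ^ 3 = Real.sqrt x1 * x1 := by rw [pow_succ, es1]; ring
      nlinarith [mul_nonneg (mul_nonneg hb.le hs0.le) hs1.le, mul_le_mul_of_nonneg_left hs01 hs1.le]
    have ecast : ((m + 1 : ℕ) : ℝ) = (m : ℝ) + 1 := by push_cast; ring
    rw [ecast]
    linarith

/-- **THE SCREENED RECURSION FOR THE ADVANTAGE.**  `B` ISOTONE with zeroth moment `M ≥ 0` and floor `b > 0` on ]0,γ], `M·γ ≤ 3√3·b`, `ε ≥ 0`; unique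
solution families `S` of `B` and `S′` of `B + ε`; a pin `y ∈ ]0,γ]`, `δ_m = 1∕(S′ y m)² − 1∕(S y m)²`.  Then for every `m`:
`δ_{m+1}·(1 + M·(S y (m+1))³∕2) ≥ δ_m + (1 − M·y∕(3√3·b))·ε` — the increment `δ_{m+1} − δ_m = ε − [B(S z′) − B(S′ z′)] − [B(S z) − B(S z′)]`
(`z = S y (m+1) ≥ z′ = S′ y (m+1)`) loses at most `q·ε` at the pin `z′` (§1, comparison there by (E49k)) and at most `(M·z³∕2)·δ_{m+1}` between the pins
((E48c)'s screening on the box ]0, z]). [folklore] -/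
theorem advantage_succ_ge (hmono : ∀ u v : ℕ → ℝ, SeqBox γ u → SeqBox γ v → (∀ j, u j ≤ v j) → B u ≤ B v)
    (hB : ∀ u u' : ℕ → ℝ, SeqBox γ u → SeqBox γ u' → ∀ D : ℝ, (∀ j, |u j - u' j| ≤ D) → |B u - B u'| ≤ M * D)
    (hM : 0 ≤ M) (hγ : 0 < γ) (hb : 0 < b) (hlo : ∀ u, SeqBox γ u → b ≤ B u) (hsmall : M * γ ≤ 3 * Real.sqrt 3 * b) (hε : 0 ≤ ε)
    (hS : ∀ p, 0 < p → p ≤ γ → SeqBox γ (S p) ∧ MemFlow B p (S p))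
    (huniq : ∀ p, 0 < p → p ≤ γ → ∀ u u' : ℕ → ℝ, SeqBox γ u → SeqBox γ u' → MemFlow B p u → MemFlow B p u' → u = u')
    (hS' : ∀ p, 0 < p → p ≤ γ → SeqBox γ (S' p) ∧ MemFlow (fun v => B v + ε) p (S' p))
    (huniq' : ∀ p, 0 < p → p ≤ γ → ∀ u u' : ℕ → ℝ, SeqBox γ u → SeqBox γ u' →
      MemFlow (fun v => B v + ε) p u → MemFlow (fun v => B v + ε) p u' → u = u')
    (hy : 0 < y) (hyγ : y ≤ γ) (m : ℕ) :
    (1 / S' y m ^ 2 - 1 / S y m ^ 2) + (1 - M * y / (3 * Real.sqrt 3 * b)) * ε ≤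
      (1 / S' y (m + 1) ^ 2 - 1 / S y (m + 1) ^ 2) * (1 + M * S y (m + 1) ^ 3 / 2) := by
  have h33 : 0 < 3 * Real.sqrt 3 * b := mul_pos three_sqrt_three_pos hb
  have hB' : ∀ u u' : ℕ → ℝ, SeqBox γ u → SeqBox γ u' → ∀ D : ℝ, (∀ j, |u j - u' j| ≤ D) →
      |(fun v => B v + ε) u - (fun v => B v + ε) u'| ≤ M * D := fun u u' hu hu' D hD => by simpa using hB u u' hu hu' D hD
  have hexc : ∀ u, SeqBox γ u → B u ≤ (fun v => B v + ε) u := fun u _ => by simpa using hε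
  have hDmono : ∀ u v : ℕ → ℝ, SeqBox γ u → SeqBox γ v → (∀ j, u j ≤ v j) →
      (fun w => B w + ε) u - B u ≤ (fun w => B w + ε) v - B v := fun u v _ _ _ => by simp
  have hlo' : ∀ u, SeqBox γ u → b ≤ (fun v => B v + ε) u := fun u hu => by simpa using (hlo u hu).trans (le_add_of_nonneg_right hε)
  have hcomp : ∀ x : ℝ, x ∈ Ioc 0 γ → ∀ j, S' x j ≤ S x j := fun x hx =>
    family_le_of_isotone_excess hmono hB hM hγ hb hlo hsmall hexc hDmono hb hB' hM hlo' hS huniq hS' huniq' hx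
  -- the two current pins z′ ≤ z
  have hz := family_mem hS hy hyγ (m + 1)
  have hz' := family_mem hS' hy hyγ (m + 1)
  have hzz' : S' y (m + 1) ≤ S y (m + 1) := hcomp y ⟨hy, hyγ⟩ (m + 1)
  -- the flow equations at scale m, read through the families
  have hflow : 1 / S y (m + 1) ^ 2 = 1 / S y m ^ 2 + B (S (S y (m + 1))) := by
    rw [← family_tail_eq hS huniq hy hyγ (m + 1)]; exact (hS y hy hyγ).2.2 m
  have hflow' : 1 / S' y (m + 1) ^ 2 = 1 / S' y m ^ 2 + (B (S' (S' y (m + 1))) + ε) := by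
    rw [← family_tail_eq hS' huniq' hy hyγ (m + 1)]; exact (hS' y hy hyγ).2.2 m
  -- (i) the drop at the pin z′: B(S z′) − B(S′ z′) ≤ q_{z′}·ε ≤ q·ε
  have hdrop : B (S (S' y (m + 1))) - B (S' (S' y (m + 1))) ≤ M * y / (3 * Real.sqrt 3 * b) * ε := by
    have h1 := drop_le_q_mul hmono hB hb hlo hz'.1 hε (hS _ hz'.1 hz'.2).1 (hS _ hz'.1 hz'.2).2 (hS' _ hz'.1 hz'.2).1
      (hS' _ hz'.1 hz'.2).2 (hcomp _ hz')
    have hz'y : S' y (m + 1) ≤ y := le_pin_of_memFlow hb hlo' (hS' y hy hyγ).1 (hS' y hy hyγ).2 (m + 1)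
    have : M * S' y (m + 1) / (3 * Real.sqrt 3 * b) * ε ≤ M * y / (3 * Real.sqrt 3 * b) * ε :=
      mul_le_mul_of_nonneg_right (div_le_div_of_nonneg_right (mul_le_mul_of_nonneg_left hz'y hM) h33.le) hε
    exact h1.trans this
  -- (ii) the pin sensitivity between z′ and z, screened on the box ]0, z]
  have hsens : B (S (S y (m + 1))) - B (S (S' y (m + 1))) ≤
      M * S y (m + 1) ^ 3 / 2 * (1 / S' y (m + 1) ^ 2 - 1 / S y (m + 1) ^ 2) := by
    set z : ℝ := S y (m + 1) with hzdef
    set z' : ℝ := S' y (m + 1) with hz'def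
    -- restrict the hypotheses to the box ]0, z]
    have hmonoz : ∀ u v : ℕ → ℝ, SeqBox z u → SeqBox z v → (∀ j, u j ≤ v j) → B u ≤ B v :=
      fun u v hu hv huv => hmono u v (seqBox_mono hz.2 hu) (seqBox_mono hz.2 hv) huv
    have hBz : ∀ u u' : ℕ → ℝ, SeqBox z u → SeqBox z u' → ∀ D : ℝ, (∀ j, |u j - u' j| ≤ D) → |B u - B u'| ≤ M * D :=
      fun u u' hu hu' D hD => hB u u' (seqBox_mono hz.2 hu) (seqBox_mono hz.2 hu') D hD
    have hloz : ∀ u, SeqBox z u → b ≤ B u := fun u hu => hlo u (seqBox_mono hz.2 hu)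
    have hSz : SeqBox z (S z) := seqBox_of_le_pin (hS z hz.1 hz.2).1 (le_pin_of_memFlow hb hlo (hS z hz.1 hz.2).1 (hS z hz.1 hz.2).2)
    have hSz' : SeqBox z (S z') :=
      seqBox_of_le_pin (hS z' hz'.1 hz'.2).1 fun j => (le_pin_of_memFlow hb hlo (hS z' hz'.1 hz'.2).1 (hS z' hz'.1 hz'.2).2 j).trans hzz'
    have hgapj : ∀ j, |S z j - S z' j| ≤ z ^ 3 / 2 * (1 / z' ^ 2 - 1 / z ^ 2) := by
      intro j
      have := abs_sub_le_of_monotone' hb hmonoz hBz hM hloz hz.1 le_rfl hz'.1 hzz' hSz hSz' (hS z hz.1 hz.2).2 (hS z' hz'.1 hz'.2).2 j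
      have hnn : 0 ≤ 1 / z' ^ 2 - 1 / z ^ 2 :=
        sub_nonneg.mpr (one_div_le_one_div_of_le (pow_pos hz'.1 2) (pow_le_pow_left₀ hz'.1.le hzz' 2))
      rwa [abs_sub_comm (1 / z ^ 2), abs_of_nonneg hnn] at this
    have := (abs_le.mp (hB _ _ (hS z hz.1 hz.2).1 (hS z' hz'.1 hz'.2).1 _ hgapj)).2
    calc B (S z) - B (S z') ≤ M * (z ^ 3 / 2 * (1 / z' ^ 2 - 1 / z ^ 2)) := this
      _ = M * z ^ 3 / 2 * (1 / z' ^ 2 - 1 / z ^ 2) := by ring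
  -- the increment identity and the linear bookkeeping
  have hinc : 1 / S' y (m + 1) ^ 2 - 1 / S y (m + 1) ^ 2 = (1 / S' y m ^ 2 - 1 / S y m ^ 2) + ε
      - (B (S (S' y (m + 1))) - B (S' (S' y (m + 1)))) - (B (S (S y (m + 1))) - B (S (S' y (m + 1)))) := by
    rw [hflow, hflow']; ring
  set c : ℝ := M * S y (m + 1) ^ 3 / 2 with hc
  set d1 : ℝ := 1 / S' y (m + 1) ^ 2 - 1 / S y (m + 1) ^ 2 with hd1
  have hsens' : B (S (S y (m + 1))) - B (S (S' y (m + 1))) ≤ c * d1 := by rw [hc, hd1]; exact hsens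
  have e : d1 * (1 + c) = d1 + c * d1 := by ring
  rw [e]
  linarith [hinc, hdrop, hsens']

/-! ## §3 The advantage grows linearly -/

/-- **THE ADVANTAGE GROWS LINEARLY: `δ_m ≥ (1 − q)·e^{−M·y∕b}·m·ε`.**  Same data.  By induction on §2 with `1∕(1+λ) ≥ e^{−λ}` and the summable damping
exponents `Σ_{j=1}^m M·(S y j)³∕2 ≤ M·y∕b` (§2 `sum_cube_envelope_le` under the asymptotic-freedom envelope `S y j ≤ (1∕y² + j·b)^{−1∕2}`). [folklore] -/
theorem advantage_ge_linear (hmono : ∀ u v : ℕ → ℝ, SeqBox γ u → SeqBox γ v → (∀ j, u j ≤ v j) → B u ≤ B v)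
    (hB : ∀ u u' : ℕ → ℝ, SeqBox γ u → SeqBox γ u' → ∀ D : ℝ, (∀ j, |u j - u' j| ≤ D) → |B u - B u'| ≤ M * D)
    (hM : 0 ≤ M) (hγ : 0 < γ) (hb : 0 < b) (hlo : ∀ u, SeqBox γ u → b ≤ B u) (hsmall : M * γ ≤ 3 * Real.sqrt 3 * b) (hε : 0 ≤ ε)
    (hS : ∀ p, 0 < p → p ≤ γ → SeqBox γ (S p) ∧ MemFlow B p (S p))
    (huniq : ∀ p, 0 < p → p ≤ γ → ∀ u u' : ℕ → ℝ, SeqBox γ u → SeqBox γ u' → MemFlow B p u → MemFlow B p u' → u = u')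
    (hS' : ∀ p, 0 < p → p ≤ γ → SeqBox γ (S' p) ∧ MemFlow (fun v => B v + ε) p (S' p))
    (huniq' : ∀ p, 0 < p → p ≤ γ → ∀ u u' : ℕ → ℝ, SeqBox γ u → SeqBox γ u' →
      MemFlow (fun v => B v + ε) p u → MemFlow (fun v => B v + ε) p u' → u = u')
    (hy : 0 < y) (hyγ : y ≤ γ) (m : ℕ) :
    (1 - M * y / (3 * Real.sqrt 3 * b)) * Real.exp (-(M * y / b)) * (m : ℝ) * ε ≤ 1 / S' y m ^ 2 - 1 / S y m ^ 2 := by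
  have h33 : 0 < 3 * Real.sqrt 3 * b := mul_pos three_sqrt_three_pos hb
  set κ : ℝ := (1 - M * y / (3 * Real.sqrt 3 * b)) * ε with hκ
  have hq1 : M * y / (3 * Real.sqrt 3 * b) ≤ 1 := by
    rw [div_le_one h33]; exact (mul_le_mul_of_nonneg_left hyγ hM).trans hsmall
  have hκ0 : 0 ≤ κ := mul_nonneg (by linarith) hε
  -- damping exponents L_m = Σ_{j<m} M (S y (j+1))³/2 and the inductive claim δ_m ≥ κ·m·e^{−L_m}
  set lam : ℕ → ℝ := fun j => M * S y (j + 1) ^ 3 / 2 with hlam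
  have hlam0 : ∀ j, 0 ≤ lam j := fun j => by
    have := (family_mem hS hy hyγ (j + 1)).1; rw [hlam]; positivity
  have hclaim : ∀ n : ℕ, κ * (n : ℝ) * Real.exp (-(∑ j ∈ range n, lam j)) ≤ 1 / S' y n ^ 2 - 1 / S y n ^ 2 := by
    intro n
    induction n with
    | zero => simp [family_zero hS hy hyγ, family_zero hS' hy hyγ]
    | succ n ih =>
      have hrec := advantage_succ_ge hmono hB hM hγ hb hlo hsmall hε hS huniq hS' huniq' hy hyγ n
      set δ0 : ℝ := 1 / S' y n ^ 2 - 1 / S y n ^ 2 with hδ0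
      set δ1 : ℝ := 1 / S' y (n + 1) ^ 2 - 1 / S y (n + 1) ^ 2 with hδ1
      set L : ℝ := ∑ j ∈ range n, lam j with hL
      have hL0 : 0 ≤ L := sum_nonneg fun j _ => hlam0 j
      have hl := hlam0 n
      have hrec' : δ0 + κ ≤ δ1 * (1 + lam n) := by rw [hδ0, hδ1, hκ]; exact hrec
      -- 1/(1+λ) ≥ e^{−λ}, e^{−L} ≤ 1
      have hexp1 : Real.exp (-lam n) * (1 + lam n) ≤ 1 := by
        have h1 : 1 + lam n ≤ Real.exp (lam n) := by have := Real.add_one_le_exp (lam n); linarith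
        calc Real.exp (-lam n) * (1 + lam n) ≤ Real.exp (-lam n) * Real.exp (lam n) :=
              mul_le_mul_of_nonneg_left h1 (Real.exp_pos _).le
          _ = 1 := by rw [← Real.exp_add]; simp
      have hexpL : Real.exp (-L) ≤ 1 := by rw [Real.exp_le_one_iff]; linarith
      have hδ1_nonneg : 0 ≤ δ1 := by
        have := mul_nonneg (mul_nonneg hκ0 (Nat.cast_nonneg n)) (Real.exp_pos (-L)).le
        have h0 : 0 ≤ δ0 := this.trans ih
        nlinarith
      rw [sum_range_succ, Nat.cast_succ, neg_add, Real.exp_add]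
      -- goal: κ (n+1) e^{−L} e^{−λ_n} ≤ δ1
      have key : κ * ((n : ℝ) + 1) * Real.exp (-L) ≤ δ1 * (1 + lam n) := by
        have : κ * ((n : ℝ) + 1) * Real.exp (-L) ≤ κ * (n : ℝ) * Real.exp (-L) + κ := by
          have := mul_le_mul_of_nonneg_left hexpL hκ0
          nlinarith
        linarith
      calc κ * ((n : ℝ) + 1) * (Real.exp (-L) * Real.exp (-lam n))
          = κ * ((n : ℝ) + 1) * Real.exp (-L) * Real.exp (-lam n) := by ring
        _ ≤ δ1 * (1 + lam n) * Real.exp (-lam n) := mul_le_mul_of_nonneg_right key (Real.exp_pos _).le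
        _ = δ1 * (Real.exp (-lam n) * (1 + lam n)) := by ring
        _ ≤ δ1 * 1 := mul_le_mul_of_nonneg_left hexp1 hδ1_nonneg
        _ = δ1 := mul_one _
  -- the damping exponents are at most M·y/b
  have hLle : ∑ j ∈ range m, lam j ≤ M * y / b := by
    have henv : ∀ j, S y (j + 1) ≤ 1 / Real.sqrt (1 / y ^ 2 + (((j : ℕ) : ℝ) + 1) * b) := by
      intro j
      have e : (((j : ℕ) : ℝ) + 1) = ((j + 1 : ℕ) : ℝ) := by push_cast; ring
      rw [e]
      have hP : 0 < 1 / y ^ 2 + ((j + 1 : ℕ) : ℝ) * b := by positivity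
      refine le_inv_sqrt_of_le_inv_sq (family_mem hS hy hyγ (j + 1)).1 hP ?_
      rw [invSq_eq_of_memFlow (hS y hy hyγ).2 (j + 1)]
      exact add_le_add le_rfl (mul_lower_le_drive hlo (hS y hy hyγ).1 (j + 1))
    have hcube : ∀ j, S y (j + 1) ^ 3 ≤ (1 / Real.sqrt (1 / y ^ 2 + (((j : ℕ) : ℝ) + 1) * b)) ^ 3 := fun j =>
      pow_le_pow_left₀ (family_mem hS hy hyγ (j + 1)).1.le (henv j) 3
    have hsum := sum_cube_envelope_le hb hy m
    have htail : 0 ≤ 2 / (b * Real.sqrt (1 / y ^ 2 + (m : ℝ) * b)) := by positivity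
    calc ∑ j ∈ range m, lam j = M / 2 * ∑ j ∈ range m, S y (j + 1) ^ 3 := by
          rw [hlam, mul_sum]; exact sum_congr rfl fun j _ => by ring
      _ ≤ M / 2 * ∑ j ∈ range m, (1 / Real.sqrt (1 / y ^ 2 + (((j : ℕ) : ℝ) + 1) * b)) ^ 3 :=
          mul_le_mul_of_nonneg_left (sum_le_sum fun j _ => hcube j) (by positivity)
      _ ≤ M / 2 * (2 * y / b) := mul_le_mul_of_nonneg_left (by linarith) (by positivity)
      _ = M * y / b := by ring
  have hexp_mono : Real.exp (-(M * y / b)) ≤ Real.exp (-(∑ j ∈ range m, lam j)) := Real.exp_le_exp.mpr (by linarith)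
  calc (1 - M * y / (3 * Real.sqrt 3 * b)) * Real.exp (-(M * y / b)) * (m : ℝ) * ε
      = κ * (m : ℝ) * Real.exp (-(M * y / b)) := by rw [hκ]; ring
    _ ≤ κ * (m : ℝ) * Real.exp (-(∑ j ∈ range m, lam j)) :=
        mul_le_mul_of_nonneg_left hexp_mono (mul_nonneg hκ0 (Nat.cast_nonneg m))
    _ ≤ 1 / S' y m ^ 2 - 1 / S y m ^ 2 := hclaim m

/-! ## §4 END: the advantage of a floor shift, family-free -/

/-- **THE SIZE OF THE ADVANTAGE OF A FLOOR SHIFT.**  `B` ISOTONE on ]0,γ] with zeroth moment `M ≥ 0`, floor `b > 0` and `M·γ ≤ 3√3·b`; `ε ≥ 0`; `h`,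
`h′` ANY box solutions of `B` and `B + ε` from one pin `p ∈ ]0,γ]`.  Then at every scale `m`:
`(1 − M·p∕(3√3·b))·e^{−M·p∕b}·m·ε ≤ 1∕h′_m² − 1∕h_m² ≤ m·ε` — the raised floor puts the recursion variable of the running coupling ahead by a definite
fraction of `m·ε`, linearly in the scale. [folklore] -/
theorem advantage_between {p : ℝ} (hmono : ∀ u v : ℕ → ℝ, SeqBox γ u → SeqBox γ v → (∀ j, u j ≤ v j) → B u ≤ B v)
    (hB : ∀ u u' : ℕ → ℝ, SeqBox γ u → SeqBox γ u' → ∀ D : ℝ, (∀ j, |u j - u' j| ≤ D) → |B u - B u'| ≤ M * D)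
    (hM : 0 ≤ M) (hb : 0 < b) (hlo : ∀ u, SeqBox γ u → b ≤ B u) (hsmall : M * γ ≤ 3 * Real.sqrt 3 * b) (hε : 0 ≤ ε)
    (hp : 0 < p) (hpγ : p ≤ γ) (hh : SeqBox γ h) (hf : MemFlow B p h) (hh' : SeqBox γ h')
    (hf' : MemFlow (fun v => B v + ε) p h') (m : ℕ) :
    (1 - M * p / (3 * Real.sqrt 3 * b)) * Real.exp (-(M * p / b)) * (m : ℝ) * ε ≤ 1 / h' m ^ 2 - 1 / h m ^ 2 ∧
      1 / h' m ^ 2 - 1 / h m ^ 2 ≤ (m : ℝ) * ε := by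
  have hγ : 0 < γ := hp.trans_le hpγ
  have hmono' : ∀ u v : ℕ → ℝ, SeqBox γ u → SeqBox γ v → (∀ j, u j ≤ v j) → (fun w => B w + ε) u ≤ (fun w => B w + ε) v :=
    fun u v hu hv huv => by simpa using hmono u v hu hv huv
  have hB' : ∀ u u' : ℕ → ℝ, SeqBox γ u → SeqBox γ u' → ∀ D : ℝ, (∀ j, |u j - u' j| ≤ D) →
      |(fun w => B w + ε) u - (fun w => B w + ε) u'| ≤ M * D := fun u u' hu hu' D hD => by simpa using hB u u' hu hu' D hD
  have hlo' : ∀ u, SeqBox γ u → b ≤ (fun w => B w + ε) u := fun u hu => by simpa using (hlo u hu).trans (le_add_of_nonneg_right hε)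
  have hexc : ∀ u, SeqBox γ u → B u ≤ (fun v => B v + ε) u := fun u _ => by simpa using hε
  have hDmono : ∀ u v : ℕ → ℝ, SeqBox γ u → SeqBox γ v → (∀ j, u j ≤ v j) →
      (fun w => B w + ε) u - B u ≤ (fun w => B w + ε) v - B v := fun u v _ _ _ => by simp
  -- the two solution families
  have hex : ∀ q : ℝ, 0 < q → q ≤ γ → ∃ k : ℕ → ℝ, SeqBox γ k ∧ MemFlow B q k := fun q hq hqγ => exists_memFlow_zm hB hM hq hqγ hb hlo
  have hex' : ∀ q : ℝ, 0 < q → q ≤ γ → ∃ k : ℕ → ℝ, SeqBox γ k ∧ MemFlow (fun w => B w + ε) q k :=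
    fun q hq hqγ => exists_memFlow_zm hB' hM hq hqγ hb hlo'
  choose! S hSb hSf using hex
  choose! S' hS'b hS'f using hex'
  have hS : ∀ q, 0 < q → q ≤ γ → SeqBox γ (S q) ∧ MemFlow B q (S q) := fun q hq hqγ => ⟨hSb q hq hqγ, hSf q hq hqγ⟩
  have hS' : ∀ q, 0 < q → q ≤ γ → SeqBox γ (S' q) ∧ MemFlow (fun w => B w + ε) q (S' q) :=
    fun q hq hqγ => ⟨hS'b q hq hqγ, hS'f q hq hqγ⟩
  have huniq : ∀ q, 0 < q → q ≤ γ → ∀ u u' : ℕ → ℝ, SeqBox γ u → SeqBox γ u' → MemFlow B q u → MemFlow B q u' → u = u' :=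
    fun q hq _ u u' hu hu' hfu hfu' => memFlow_unique_of_monotone_zm hmono hB hM hq hb hlo hu hu' hfu hfu'
  have huniq' : ∀ q, 0 < q → q ≤ γ → ∀ u u' : ℕ → ℝ, SeqBox γ u → SeqBox γ u' →
      MemFlow (fun w => B w + ε) q u → MemFlow (fun w => B w + ε) q u' → u = u' :=
    fun q hq _ u u' hu hu' hfu hfu' => memFlow_unique_of_monotone_zm hmono' hB' hM hq hb hlo' hu hu' hfu hfu'
  have e : h = S p := huniq p hp hpγ _ _ hh (hS p hp hpγ).1 hf (hS p hp hpγ).2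
  have e' : h' = S' p := huniq' p hp hpγ _ _ hh' (hS' p hp hpγ).1 hf' (hS' p hp hpγ).2
  rw [e, e']
  refine ⟨advantage_ge_linear hmono hB hM hγ hb hlo hsmall hε hS huniq hS' huniq' hp hpγ m, ?_⟩
  exact advantage_le_linear hmono hS hS' hp hpγ
    (family_le_of_isotone_excess hmono hB hM hγ hb hlo hsmall hexc hDmono hb hB' hM hlo' hS huniq hS' huniq' ⟨hp, hpγ⟩) m

end Summit.QuantumFields.BalabanUV.Beta.EriceRemainderEnclosureHistoryAutonomyComparisonAdvantage

end
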